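/-
Copyright (c) 2026 the pub-hodgecm-mathlib formalisation cell (harness21).  Prover seat hodgecm-mathlib-K2Liu-p13 (g2), Track B «K2-LIT»,
#184♮ = hLiu418 = `stmt-HodgeConjecture-24832`; Road I v3 organ U1-CT-ind STAGE 2 (Q2), file F4 (LEAD F0P6-plan (g14) 10:39:33Z «F4-2 → F4 → F5 → D-U1 stage 3 =»;
CENSUS-Q2-F4 `K2/K2Liu-p13/g2/CENSUS-Q2-F4-KlingenUnfold.K2Liu-p13-g2.md`).
-/
import Summits.HodgeConjecture.HodgeConjecture.Theorems.K2LiuSiegelEisensteinSubgroupPeriodCells   -- ★ F4-2a: `integral_wt_smul_eisensteinSeriesDelta_eq_add_tsum_compl`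
import Summits.HodgeConjecture.HodgeConjecture.Theorems.K2LiuKlingenCellOneConstant                 -- ★ F4-1f: `apply_transport_klingen_mul_klingenUnipA` (+ ★ F4-1c, F4-1, F3″)
import Summits.HodgeConjecture.HodgeConjecture.Theorems.K2LiuSiegelBruhatMiddleCellDelta           -- ★ B2b: `mk_eq_mk_iff_isSiegelDelta`
import HarnessLib

/-!
# Crux `HLiu418`, Road I v3, organ U1 stage 2 (Q2), file F4: THE Q-CONSTANT TERM OF THE SIEGEL EISENSTEIN SERIES ON `U(2,2)` — TWO CELLS
# `∫ β(u) • E^Δ(u h; f) dνN(u) = (∫ β dνN) • Σ'_{x ∈ C₁} f(γ_x h) + Σ'_{x ∈ C₁ᶜ} ∫ β(u) • f(γ_x u h) dνN(u)`,  `C₁ = {⟦Ψ(q)⟧ : q ∈ Q(L⁺)}`,  `C₁ᶜ = {⟦Ψ(ξ q)⟧ : q ∈ Q(L⁺)}`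

Cell `hodgecm-mathlib`, crux item hLiu418 = `stmt-HodgeConjecture-24832`; squad K2 ∕ K2Liu; LEAD F0P6-plan (g14), co-dealer K2E5-plan (g7); prover K2Liu-p13 (g2).
THEOREMS ONLY (no `def`, no instance, no notation, no named-fact hypothesis, no `sorry`); lane `--supports stmt-HodgeConjecture-24832 --as helper` (count-neutral).
`n = 2`.  The transport `Ψ : U(J₄)(𝔸_{L⁺}) ≃ₜ* H(𝔸)` and ★ F3's clauses (T1)(T3)(T4) (+ `XY = YX = a·1`) are hypotheses BY VALUE (consumers `obtain` them once from
★ F3 `exists_antidiagonal_transport`).  The Q-CONSTANT TERM is read in covering-weight currency (★ G0 `K2LiuKlingenConstantTermFamilyClauses`, K2Liu-p01):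
`CT_Q φ h = ∫ u, (β u).toReal • φ(↑u · h) ∂νN` over `N_Q(𝔸) = ↥(klingenUnipA Ψ)` (★ F4-1) with an `N_Q(L⁺)`-covering weight `β` (`N_Q(L⁺) = (ratH).subgroupOf (klingenUnipA Ψ)`);
this file only uses `β ≤ 1` measurable and ANY measure `νN` (left-invariance enters with the orbit regrouping, ★ F4-2b).  The IDENTITY CELL is carried as a SET OF CLASSES
`C₁ ⊆ P_Δ(L⁺)\H(L⁺)` given by its membership law `x ∈ C₁ ↔ ∃ q ∈ Q(L⁺), ∃ γ ∈ H(L⁺), γ = Ψ(q) ∧ x = ⟦γ⟧` (BY VALUE, so the consumer names it as it likes).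
* §0 `mem_siegelFour_of_toBlocks₂₁_map_eq_zero` (converse of ★ F4-1c `toBlocks₂₁_eq_zero_of_mem_siegelFour` for an injective ring map).
* §1 **`apply_out_mul_coe_eq_of_exists_klingen`** — on an identity-cell class the `N_Q(𝔸)`-integrand is CONSTANT: `f(γ_x u h) = f(γ_x h)` (`x = ⟦Ψ q⟧`, `q ∈ Q(L⁺)`, `u ∈ N_Q(𝔸)`;
  ★ F4-1f `apply_transport_klingen_mul_klingenUnipA` + representative independence ★ O41.4 (b) `apply_out_mk_mul`).
* §2 THE COMPLEMENT IS THE `ξ`-CELL: `exists_klingen_weylXi_of_not_exists` (★ F4-1c `siegelDeltaQuot_two_cells`) and `not_exists_klingen_of_eq_transport_weylXi_mul`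
  (★ F4-1c `ratH_two_cells_disjoint` + ★ F3″ `transport_symm_mem_range` ∕ `isSiegelDelta_transport_iff`): `x ∉ C₁ ↔ ∃ q ∈ Q(L⁺), x = ⟦Ψ(ξ q)⟧` (`mem_compl_cellOne_iff`).
* §3 **`klingenConstTerm_two_cells`** — under the analytic binder (H) `∫⁻ (Σ'_x ‖f(γ_x u h)‖ₑ) β dνN ≠ ∞` (absolute convergence over one weighted fundamental domain,
  `re s > 1` by socket #9 + local uniformity), for a continuous Siegel section `f` of `I_Δ(s, χ)`:
  `∫ β(u) • E^Δ(u h; f) dνN(u) = (∫ β dνN) • Σ'_{x ∈ C₁} f(γ_x h) + Σ'_{x ∈ C₁ᶜ} ∫ β(u) • f(γ_x u h) dνN(u)` (★ F4-2a at `C := C₁`), both pieces absolutely summable.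
NEXT (F4-3 ∕ F5): `C₁ ≅ B₂(L⁺)\U(J₂)(L⁺)` via `q = m_Q(1,δ)·n` (term 1 `= vol · E^{(1)}(g′, s+½; i^*f)`), `C₁ᶜ = ⨆_δ O(⟦Ψ(ξ m_Q(1,δ))⟧)` with stabilisers `Ψ(m⁻¹ u₊(L⁺) m)`
(★ F4-0 §3) regrouped by ★ F4-2b `tsum_section_eq_integral_wt_smul_subgroup` (term 2 `= vol′ · E^{(1)}(g′, s−½; i^*M(ξ,s)f)`).
[Xiong2013 §4 Prop. 4.1, §7 L. 7.1], [GanTakeda2011SiegelWeil §7.2 p. 23], [MoeglinWaldspurger1995 II.1.7], [KudlaRallis1994 §2], [Garrett2018 §3.10].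
HONEST LABEL.  Count-neutral helper: `HC_CM` is proved only modulo the 7 printed citations (2 remaining named inputs: hLiu418 = `stmt-HodgeConjecture-24832`,
h413 = `stmt-HodgeConjecture-24833`) until rung 0 closes.
-/

set_option autoImplicit false
set_option linter.dupNamespace false -- the mandated namespace repeats `HodgeConjecture.HodgeConjecture`

noncomputable section

open scoped Matrix ENNReal NNReal
open NumberField IsDedekindDomain MeasureTheory MeasureTheory.Measure Filter Set Function

namespace Summit.HodgeConjecture.HodgeConjecture.Cruxes.HLiu418.K2LiuKlingenConstantTermUnfold

open Literature.NumberTheory.Automorphic Literature.NumberTheory.Automorphic.UnitaryGroup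
open Literature.NumberTheory.GelbartRogawski1991 Literature.NumberTheory.GelbartRogawski1991.GRConstruction
open Literature.NumberTheory.GaloisRepresentations
open Literature.NumberTheory.K2Lit.SiegelDoubled Literature.MeasureTheory.Group
open Summit.HodgeConjecture.HodgeConjecture.Cruxes.HLiu418.K2LiuDoubledUTwoTwoBorelFrame
open Summit.HodgeConjecture.HodgeConjecture.Cruxes.HLiu418.K2LiuKlingenParabolicDefs
open Summit.HodgeConjecture.HodgeConjecture.Cruxes.HLiu418.K2LiuKlingenUnipotentAdelicDefs
open Summit.HodgeConjecture.HodgeConjecture.Cruxes.HLiu418.K2LiuKlingenRationalCells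
open Summit.HodgeConjecture.HodgeConjecture.Cruxes.HLiu418.K2LiuKlingenCellOneConstant (apply_transport_klingen_mul_klingenUnipA)
open Summit.HodgeConjecture.HodgeConjecture.Cruxes.HLiu418.K2LiuDoubledAntidiagonalTransportRational (isSiegelDelta_transport_iff transport_symm_mem_range)
open Summit.HodgeConjecture.HodgeConjecture.Cruxes.HLiu418.K2LiuSiegelBruhatMiddleCellDelta (mk_eq_mk_iff_isSiegelDelta)
open Summit.HodgeConjecture.HodgeConjecture.Cruxes.HLiu418.K2LiuConstantTermBigCellUnfold (apply_out_mk_mul)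
open Summit.HodgeConjecture.HodgeConjecture.Cruxes.HLiu418.K2LiuSiegelEisensteinSubgroupPeriodCells
open UnitaryDualPair

/-! ## §0 The Siegel parabolic of `U(J₄)` through an injective ring map -/

section Generic

variable {R S : Type*} [CommRing R] [CommRing S] {σ : R →+* R}

/-- **`p ∈ P` iff the lower-left `e₂`-block of `p.map ι` vanishes**, for an injective `ι` (converse of ★ F4-1c `toBlocks₂₁_eq_zero_of_mem_siegelFour`).
[cite: HarrisKudlaSweet1996, §1 (1.11)] -/
theorem mem_siegelFour_of_toBlocks₂₁_map_eq_zero {ι : R →+* S} (hι : Function.Injective ι) {p : unitaryGroupOfForm σ ((StdForm.antidiagonal 4).over R)}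
    (h : (Matrix.reindex (e₂ (n := 2)).symm (e₂ (n := 2)).symm (((p : GL (Fin 4) R) : Matrix (Fin 4) (Fin 4) R).map ι)).toBlocks₂₁ = 0) :
    p ∈ siegelFour R σ := by
  have key : ∀ i j : Fin 2, ((p : GL (Fin 4) R) : Matrix (Fin 4) (Fin 4) R) (Fin.natAdd 2 i) (Fin.castAdd 2 j) = 0 := by
    intro i j
    have hij := congrFun (congrFun h i) j
    simp only [Matrix.toBlocks₂₁, Matrix.of_apply, Matrix.reindex_apply, Equiv.symm_symm, Matrix.submatrix_apply, Matrix.map_apply,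
      finSumFinEquiv_apply_right, finSumFinEquiv_apply_left, Matrix.zero_apply] at hij
    exact hι (by rw [hij, map_zero])
  rw [mem_siegelFour_iff]
  refine ⟨?_, ?_, ?_, ?_⟩
  · exact key 0 0
  · exact key 0 1
  · exact key 1 0
  · exact key 1 1

end Generic

variable {L : Type} [Field L] [NumberField L] [IsCMField L]
variable {N M : ℕ} {e : Fin N × Fin M ≃ Fin 2}
  {dV : Fin N → L} {hdV : ∀ i, IsCMField.complexConj L (dV i) = dV i}
  {dW : Fin M → L} {hdW : ∀ i, IsCMField.complexConj L (dW i) = dW i}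

section Transport

variable {SA : GL (Fin (2 + 2)) (AdeleRing (𝓞 L) L)}
  {Ψ : (quasiSplit (Fp L) L (IsCMField.complexConj L) (2 + 2)).Adelic ≃ₜ* HA L e dV hdV dW hdW} {X Y : Matrix (Fin 2) (Fin 2) (Fp L)} {a : Fp L}
  (hΨ : ∀ g : (quasiSplit (Fp L) L (IsCMField.complexConj L) (2 + 2)).Adelic,
    (((Ψ g : HA L e dV hdV dW hdW) : GL (Fin (2 + 2)) (AdeleRing (𝓞 L) L)) : Matrix (Fin (2 + 2)) (Fin (2 + 2)) (AdeleRing (𝓞 L) L)) =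
      (SA : Matrix (Fin (2 + 2)) (Fin (2 + 2)) (AdeleRing (𝓞 L) L)) *
        ((adelicVal (Fp L) L (IsCMField.complexConj L) (2 + 2) _ g : GL (Fin (2 + 2)) (AdeleRing (𝓞 L) L)) :
          Matrix (Fin (2 + 2)) (Fin (2 + 2)) (AdeleRing (𝓞 L) L)) *
        ((SA⁻¹ : GL (Fin (2 + 2)) (AdeleRing (𝓞 L) L)) : Matrix (Fin (2 + 2)) (Fin (2 + 2)) (AdeleRing (𝓞 L) L)))
  (ha : a + a = 1)
  (hSA : Matrix.reindex (e₂ (n := 2)).symm (e₂ (n := 2)).symm (SA : Matrix (Fin (2 + 2)) (Fin (2 + 2)) (AdeleRing (𝓞 L) L)) =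
    Matrix.fromBlocks (1 : Matrix (Fin 2) (Fin 2) (AdeleRing (𝓞 L) L)) (X.map ((algebraMap L (AdeleRing (𝓞 L) L)).comp (algebraMap (Fp L) L))) 1
      (-(X.map ((algebraMap L (AdeleRing (𝓞 L) L)).comp (algebraMap (Fp L) L)))))
  (hSAi : Matrix.reindex (e₂ (n := 2)).symm (e₂ (n := 2)).symm ((SA⁻¹ : GL (Fin (2 + 2)) (AdeleRing (𝓞 L) L)) : Matrix (Fin (2 + 2)) (Fin (2 + 2)) (AdeleRing (𝓞 L) L)) =
    Matrix.fromBlocks ((a • (1 : Matrix (Fin 2) (Fin 2) (Fp L))).map ((algebraMap L (AdeleRing (𝓞 L) L)).comp (algebraMap (Fp L) L)))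
      ((a • (1 : Matrix (Fin 2) (Fin 2) (Fp L))).map ((algebraMap L (AdeleRing (𝓞 L) L)).comp (algebraMap (Fp L) L)))
      (Y.map ((algebraMap L (AdeleRing (𝓞 L) L)).comp (algebraMap (Fp L) L)))
      (-(Y.map ((algebraMap L (AdeleRing (𝓞 L) L)).comp (algebraMap (Fp L) L)))))
  (hΨP : ∀ b : (quasiSplit (Fp L) L (IsCMField.complexConj L) (2 + 2)).Adelic,
    ((adelicVal (Fp L) L (IsCMField.complexConj L) (2 + 2) _ b : GL (Fin (2 + 2)) (AdeleRing (𝓞 L) L)) :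
        Matrix (Fin (2 + 2)) (Fin (2 + 2)) (AdeleRing (𝓞 L) L)).BlockTriangular id →
      IsSiegelDelta L e dV hdV dW hdW (Ψ b))
  (hXY : X * Y = a • (1 : Matrix (Fin 2) (Fin 2) (Fp L))) (hYX : Y * X = a • (1 : Matrix (Fin 2) (Fin 2) (Fp L)))

/-! ## §1 The identity cell: the `N_Q(𝔸)`-integrand of an identity-cell class is constant -/

include hΨ ha hSA hSAi hΨP in
/-- **ON AN IDENTITY-CELL CLASS THE `N_Q(𝔸)`-INTEGRAND IS CONSTANT**: if `x = ⟦γ⟧` with `γ = Ψ(q)`, `q ∈ Q(L⁺) = klingen L c`, then `f(γ_x · u · h) = f(γ_x · h)` for every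
`u ∈ N_Q(𝔸) = klingenUnipA Ψ` and every Siegel section `f` of `I_Δ(s, χ)` (`γ_x = p γ`, `p ∈ P_Δ(L⁺)`; `Q(L⁺)` normalises `N_Q(𝔸)` ★ F4-1f; sections are `N_Q(𝔸)`-invariant ★ F4-1).
So every identity-cell class is FIXED by `N_Q(L⁺)` and contributes `vol_β · f(γ_x h)` to the Q-constant term. [cite: Xiong2013, §4 Prop. 4.1] [cite: MoeglinWaldspurger1995, II.1.7] -/
theorem apply_out_mul_coe_eq_of_exists_klingen {χ : HeckeCharacter L} {s : ℂ} {f : HA L e dV hdV dW hdW → ℂ} (hf : IsSiegelDeltaSection L e dV hdV dW hdW χ s f)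
    {x : SiegelDeltaQuot L e dV hdV dW hdW}
    (hx : ∃ q ∈ klingen L ((IsCMField.complexConj L : L ≃ₐ[Fp L] L) : L →+* L), ∃ γ : ratH L e dV hdV dW hdW,
      (γ : HA L e dV hdV dW hdW) = Ψ (UnitaryGroup.toAdelic (Fp L) L (IsCMField.complexConj L) (2 + 2) ((StdForm.antidiagonal (2 + 2)).over L) q) ∧
        x = Quotient.mk (MulAction.orbitRel (siegelDeltaRat L e dV hdV dW hdW) (ratH L e dV hdV dW hdW)) γ)
    (u : ↥(klingenUnipA Ψ)) (h : HA L e dV hdV dW hdW) :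
    f ((((Quotient.out x : ratH L e dV hdV dW hdW) : HA L e dV hdV dW hdW)) * ((u : HA L e dV hdV dW hdW) * h)) =
      f ((((Quotient.out x : ratH L e dV hdV dW hdW) : HA L e dV hdV dW hdW)) * h) := by
  obtain ⟨q, hq, γ, hγ, rfl⟩ := hx
  rw [apply_out_mk_mul hf γ, apply_out_mk_mul hf γ, hγ, ← mul_assoc]
  exact apply_transport_klingen_mul_klingenUnipA hΨ ha hSA hSAi hΨP hf hq u.2 h

/-! ## §2 The complement of the identity cell is the `ξ`-cell -/

include hΨ ha hSA hSAi hXY hYX in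
/-- **a class off the identity cell is `⟦Ψ(ξ q)⟧`, `q ∈ Q(L⁺)`** (★ F4-1c `siegelDeltaQuot_two_cells`). [cite: Xiong2013, §7 Lemma 7.1] [cite: GanTakeda2011SiegelWeil, §7.2 p. 23] -/
theorem exists_klingen_weylXi_of_not_exists (x : SiegelDeltaQuot L e dV hdV dW hdW)
    (hx : ¬ ∃ q ∈ klingen L ((IsCMField.complexConj L : L ≃ₐ[Fp L] L) : L →+* L), ∃ γ : ratH L e dV hdV dW hdW,
      (γ : HA L e dV hdV dW hdW) = Ψ (UnitaryGroup.toAdelic (Fp L) L (IsCMField.complexConj L) (2 + 2) ((StdForm.antidiagonal (2 + 2)).over L) q) ∧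
        x = Quotient.mk (MulAction.orbitRel (siegelDeltaRat L e dV hdV dW hdW) (ratH L e dV hdV dW hdW)) γ) :
    ∃ q ∈ klingen L ((IsCMField.complexConj L : L ≃ₐ[Fp L] L) : L →+* L), ∃ γ : ratH L e dV hdV dW hdW,
      (γ : HA L e dV hdV dW hdW) = Ψ (UnitaryGroup.toAdelic (Fp L) L (IsCMField.complexConj L) (2 + 2) ((StdForm.antidiagonal (2 + 2)).over L)
        (weylXi L ((IsCMField.complexConj L : L ≃ₐ[Fp L] L) : L →+* L) * q)) ∧
        x = Quotient.mk (MulAction.orbitRel (siegelDeltaRat L e dV hdV dW hdW) (ratH L e dV hdV dW hdW)) γ := by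
  obtain ⟨q, hq, hcell⟩ := siegelDeltaQuot_two_cells hΨ ha hSA hSAi hXY hYX x
  rcases hcell with h1 | h2
  · exact absurd ⟨q, hq, _, rfl, h1⟩ hx
  · exact ⟨q, hq, _, rfl, h2⟩

include hΨ ha hSA hSAi hXY hYX in
/-- **… and `⟦Ψ(ξ q)⟧` is NOT an identity-cell class** (`P·Q ∩ P·ξ·Q = ∅`: ★ F4-1c `ratH_two_cells_disjoint`; the rational Siegel factor relating two representatives is
pulled back through `Ψ` by ★ F3″ `transport_symm_mem_range` ∕ `isSiegelDelta_transport_iff` and §0). [cite: Xiong2013, §7 Lemma 7.1] -/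
theorem not_exists_klingen_of_eq_transport_weylXi_mul {q : unitaryGroupOfForm ((IsCMField.complexConj L : L ≃ₐ[Fp L] L) : L →+* L) ((StdForm.antidiagonal 4).over L)}
    (hq : q ∈ klingen L ((IsCMField.complexConj L : L ≃ₐ[Fp L] L) : L →+* L)) {γ : ratH L e dV hdV dW hdW}
    (hγ : (γ : HA L e dV hdV dW hdW) = Ψ (UnitaryGroup.toAdelic (Fp L) L (IsCMField.complexConj L) (2 + 2) ((StdForm.antidiagonal (2 + 2)).over L)
      (weylXi L ((IsCMField.complexConj L : L ≃ₐ[Fp L] L) : L →+* L) * q))) :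
    ¬ ∃ q' ∈ klingen L ((IsCMField.complexConj L : L ≃ₐ[Fp L] L) : L →+* L), ∃ γ' : ratH L e dV hdV dW hdW,
      (γ' : HA L e dV hdV dW hdW) = Ψ (UnitaryGroup.toAdelic (Fp L) L (IsCMField.complexConj L) (2 + 2) ((StdForm.antidiagonal (2 + 2)).over L) q') ∧
        (Quotient.mk (MulAction.orbitRel (siegelDeltaRat L e dV hdV dW hdW) (ratH L e dV hdV dW hdW)) γ : SiegelDeltaQuot L e dV hdV dW hdW) =
          Quotient.mk (MulAction.orbitRel (siegelDeltaRat L e dV hdV dW hdW) (ratH L e dV hdV dW hdW)) γ' := by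
  rintro ⟨q', hq', γ', hγ', hmk⟩
  -- the rational Siegel factor `p = γ' γ⁻¹ ∈ P_Δ(𝔸) ∩ H(L⁺)` and its preimage `p₀ ∈ P(L⁺)` under `Ψ ∘ toAdelic`
  have hP : IsSiegelDelta L e dV hdV dW hdW (((γ' : ratH L e dV hdV dW hdW) : HA L e dV hdV dW hdW) * ((γ : ratH L e dV hdV dW hdW) : HA L e dV hdV dW hdW)⁻¹) :=
    (mk_eq_mk_iff_isSiegelDelta γ γ').1 hmk
  obtain ⟨p₀, hp₀⟩ := transport_symm_mem_range hΨ ha hSA hSAi hXY hYX (γ' * γ⁻¹ : ratH L e dV hdV dW hdW).2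
  have hp' : (((γ' * γ⁻¹ : ratH L e dV hdV dW hdW)) : HA L e dV hdV dW hdW) =
      Ψ (UnitaryGroup.toAdelic (Fp L) L (IsCMField.complexConj L) (2 + 2) ((StdForm.antidiagonal (2 + 2)).over L) p₀) := by
    rw [hp₀, ContinuousMulEquiv.apply_symm_apply]
  have hp₀P : p₀ ∈ siegelFour L ((IsCMField.complexConj L : L ≃ₐ[Fp L] L) : L →+* L) := by
    have h1 : IsSiegelDelta L e dV hdV dW hdW (Ψ (UnitaryGroup.toAdelic (Fp L) L (IsCMField.complexConj L) (2 + 2) ((StdForm.antidiagonal (2 + 2)).over L) p₀)) := by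
      rw [← hp']; exact hP
    have h2 := (isSiegelDelta_transport_iff hΨ ha hSA hSAi hYX _).1 h1
    rw [coe_adelicVal_toAdelic L (2 + 2) p₀] at h2
    exact mem_siegelFour_of_toBlocks₂₁_map_eq_zero (NumberField.AdeleRing.algebraMap_injective (𝓞 L) L) h2
  refine ratH_two_cells_disjoint Ψ (one_mem _) hq' hp₀P hq ?_
  have h1 : Ψ (UnitaryGroup.toAdelic (Fp L) L (IsCMField.complexConj L) (2 + 2) ((StdForm.antidiagonal (2 + 2)).over L)
      (1 : unitaryGroupOfForm ((IsCMField.complexConj L : L ≃ₐ[Fp L] L) : L →+* L) ((StdForm.antidiagonal 4).over L))) = 1 :=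
    (congrArg Ψ (map_one _)).trans (map_one Ψ)
  rw [h1, one_mul, ← hγ', mul_assoc, ← transport_toAdelic_mul, ← hγ, ← hp', Subgroup.coe_mul, InvMemClass.coe_inv, inv_mul_cancel_right]

include hΨ ha hSA hSAi hXY hYX in
/-- **THE COMPLEMENT OF THE IDENTITY CELL IS THE `ξ`-CELL**: for a set `C₁` of classes with the identity-cell membership law, `x ∉ C₁ ↔ ∃ q ∈ Q(L⁺), x = ⟦Ψ(ξ q)⟧`.
[cite: Xiong2013, §7 Lemma 7.1] [cite: GanTakeda2011SiegelWeil, §7.2 p. 23] -/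
theorem mem_compl_cellOne_iff (C₁ : Set (SiegelDeltaQuot L e dV hdV dW hdW))
    (hC₁ : ∀ x, x ∈ C₁ ↔ ∃ q ∈ klingen L ((IsCMField.complexConj L : L ≃ₐ[Fp L] L) : L →+* L), ∃ γ : ratH L e dV hdV dW hdW,
      (γ : HA L e dV hdV dW hdW) = Ψ (UnitaryGroup.toAdelic (Fp L) L (IsCMField.complexConj L) (2 + 2) ((StdForm.antidiagonal (2 + 2)).over L) q) ∧
        x = Quotient.mk (MulAction.orbitRel (siegelDeltaRat L e dV hdV dW hdW) (ratH L e dV hdV dW hdW)) γ)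
    (x : SiegelDeltaQuot L e dV hdV dW hdW) :
    x ∈ C₁ᶜ ↔ ∃ q ∈ klingen L ((IsCMField.complexConj L : L ≃ₐ[Fp L] L) : L →+* L), ∃ γ : ratH L e dV hdV dW hdW,
      (γ : HA L e dV hdV dW hdW) = Ψ (UnitaryGroup.toAdelic (Fp L) L (IsCMField.complexConj L) (2 + 2) ((StdForm.antidiagonal (2 + 2)).over L)
        (weylXi L ((IsCMField.complexConj L : L ≃ₐ[Fp L] L) : L →+* L) * q)) ∧
        x = Quotient.mk (MulAction.orbitRel (siegelDeltaRat L e dV hdV dW hdW) (ratH L e dV hdV dW hdW)) γ := by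
  rw [Set.mem_compl_iff, hC₁]
  refine ⟨exists_klingen_weylXi_of_not_exists hΨ ha hSA hSAi hXY hYX x, ?_⟩
  rintro ⟨q, hq, γ, hγ, rfl⟩
  exact not_exists_klingen_of_eq_transport_weylXi_mul hΨ ha hSA hSAi hXY hYX hq hγ

/-! ## §3 The Q-constant term: two cells -/

include hΨ ha hSA hSAi hΨP in
/-- **(Q2) F4 — THE Q-CONSTANT TERM OF THE SIEGEL EISENSTEIN SERIES ON `U(2,2)` SPLITS INTO TWO CELLS.**  Let `Ψ` be the transport (★ F3, clauses (T1)(T3)(T4)),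
`N_Q(𝔸) = klingenUnipA Ψ` the adelic Klingen unipotent (★ F4-1) with a Borel structure, `νN` a measure on it, `β ≤ 1` a measurable weight (an `N_Q(L⁺)`-covering weight
makes the left side the constant term `∫_{N_Q(L⁺)\N_Q(𝔸)} E(u h) du`), `f` a continuous Siegel section of `I_Δ(s, χ)`, `h ∈ H(𝔸)`, `C₁` the identity cell
(`x ∈ C₁ ↔ x = ⟦Ψ q⟧`, `q ∈ Q(L⁺)`), and assume the analytic binder (H) `∫⁻ (Σ'_x ‖f(γ_x u h)‖ₑ) β dνN ≠ ∞`.  THEN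
  `∫ β(u) • E^Δ(u h; f) dνN(u) = (∫ β dνN) • Σ'_{x ∈ C₁} f(γ_x h) + Σ'_{x ∈ C₁ᶜ} ∫ β(u) • f(γ_x u h) dνN(u)`,
`γ_x = Quotient.out x`; every class of `C₁ᶜ` is `⟦Ψ(ξ q)⟧` (`mem_compl_cellOne_iff`).  Identity cell: `P\P·Q`, integrand constant (§1); `ξ`-cell: `P\P·ξ·Q`, to be regrouped
into `N_Q(L⁺)`-orbits (★ F4-2b) — `E_Q = E^{(1)}(s+½; i^*f) ⊕ E^{(1)}(s−½; i^*M(ξ,s)f)` after F5's identifications.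
[cite: MoeglinWaldspurger1995, II.1.7] [cite: Xiong2013, §4 Prop. 4.1] [cite: GanTakeda2011SiegelWeil, §7.2 p. 23] [cite: KudlaRallis1994, §2] [cite: Garrett2018, §3.10] -/
theorem klingenConstTerm_two_cells [MeasurableSpace ↥(klingenUnipA Ψ)] [BorelSpace ↥(klingenUnipA Ψ)] (νN : Measure ↥(klingenUnipA Ψ))
    {β : ↥(klingenUnipA Ψ) → ℝ≥0∞} (hβm : Measurable β) (hβ1 : ∀ u, β u ≤ 1)
    {χ : HeckeCharacter L} {s : ℂ} {f : HA L e dV hdV dW hdW → ℂ} (hf : IsSiegelDeltaSection L e dV hdV dW hdW χ s f) (hfc : Continuous f)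
    (h : HA L e dV hdV dW hdW)
    (hH : ∫⁻ u, (∑' x : SiegelDeltaQuot L e dV hdV dW hdW,
        ‖f ((((Quotient.out x : ratH L e dV hdV dW hdW) : HA L e dV hdV dW hdW)) * ((u : HA L e dV hdV dW hdW) * h))‖ₑ) * β u ∂νN ≠ ∞)
    (C₁ : Set (SiegelDeltaQuot L e dV hdV dW hdW))
    (hC₁ : ∀ x, x ∈ C₁ ↔ ∃ q ∈ klingen L ((IsCMField.complexConj L : L ≃ₐ[Fp L] L) : L →+* L), ∃ γ : ratH L e dV hdV dW hdW,
      (γ : HA L e dV hdV dW hdW) = Ψ (UnitaryGroup.toAdelic (Fp L) L (IsCMField.complexConj L) (2 + 2) ((StdForm.antidiagonal (2 + 2)).over L) q) ∧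
        x = Quotient.mk (MulAction.orbitRel (siegelDeltaRat L e dV hdV dW hdW) (ratH L e dV hdV dW hdW)) γ) :
    ∫ u, (β u).toReal • eisensteinSeriesDelta L e dV hdV dW hdW f ((u : HA L e dV hdV dW hdW) * h) ∂νN =
      (∫ u, (β u).toReal ∂νN) • (∑' x : C₁, f ((((Quotient.out (x : SiegelDeltaQuot L e dV hdV dW hdW) : ratH L e dV hdV dW hdW) :
          HA L e dV hdV dW hdW)) * h)) +
        ∑' x : ↥(C₁ᶜ), ∫ u, (β u).toReal • f ((((Quotient.out (x : SiegelDeltaQuot L e dV hdV dW hdW) : ratH L e dV hdV dW hdW) :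
          HA L e dV hdV dW hdW)) * ((u : HA L e dV hdV dW hdW) * h)) ∂νN :=
  integral_wt_smul_eisensteinSeriesDelta_eq_add_tsum_compl νN hβm hβ1 hfc h hH C₁ fun x hx u =>
    apply_out_mul_coe_eq_of_exists_klingen hΨ ha hSA hSAi hΨP hf ((hC₁ x).1 hx) u h

/-- **the `ξ`-cell series is absolutely summable** under (H) (★ F4-2a), ready for the orbit regrouping of ★ F4-2b. [cite: MoeglinWaldspurger1995, II.1.7] -/
theorem summable_cellXi_integral_wt_smul [MeasurableSpace ↥(klingenUnipA Ψ)] [BorelSpace ↥(klingenUnipA Ψ)] (νN : Measure ↥(klingenUnipA Ψ))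
    {β : ↥(klingenUnipA Ψ) → ℝ≥0∞} (hβm : Measurable β) (hβ1 : ∀ u, β u ≤ 1)
    {f : HA L e dV hdV dW hdW → ℂ} (hfc : Continuous f) (h : HA L e dV hdV dW hdW)
    (hH : ∫⁻ u, (∑' x : SiegelDeltaQuot L e dV hdV dW hdW,
        ‖f ((((Quotient.out x : ratH L e dV hdV dW hdW) : HA L e dV hdV dW hdW)) * ((u : HA L e dV hdV dW hdW) * h))‖ₑ) * β u ∂νN ≠ ∞)
    (C₁ : Set (SiegelDeltaQuot L e dV hdV dW hdW)) :
    Summable fun x : ↥(C₁ᶜ) => ∫ u, (β u).toReal • f ((((Quotient.out (x : SiegelDeltaQuot L e dV hdV dW hdW) : ratH L e dV hdV dW hdW) :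
      HA L e dV hdV dW hdW)) * ((u : HA L e dV hdV dW hdW) * h)) ∂νN :=
  summable_integral_wt_smul_apply_out_subtype νN hβm hβ1 hfc h hH _

include hΨ ha hSA hSAi hΨP in
/-- **THE IDENTITY-CELL SERIES IS ABSOLUTELY SUMMABLE WHEN `vol_β ≠ 0`**: under (H), `x ↦ f(γ_x h)` is summable over `C₁` as soon as `∫ β dνN ≠ 0` (each identity-cell integral
is `(∫ β) • f(γ_x h)`, §1, and the series of integrals is summable, ★ F4-2a). [cite: MoeglinWaldspurger1995, II.1.7] -/
theorem summable_cellOne_apply_out [MeasurableSpace ↥(klingenUnipA Ψ)] [BorelSpace ↥(klingenUnipA Ψ)] (νN : Measure ↥(klingenUnipA Ψ))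
    {β : ↥(klingenUnipA Ψ) → ℝ≥0∞} (hβm : Measurable β) (hβ1 : ∀ u, β u ≤ 1) (hvol : (∫ u, (β u).toReal ∂νN) ≠ 0)
    {χ : HeckeCharacter L} {s : ℂ} {f : HA L e dV hdV dW hdW → ℂ} (hf : IsSiegelDeltaSection L e dV hdV dW hdW χ s f) (hfc : Continuous f)
    (h : HA L e dV hdV dW hdW)
    (hH : ∫⁻ u, (∑' x : SiegelDeltaQuot L e dV hdV dW hdW,
        ‖f ((((Quotient.out x : ratH L e dV hdV dW hdW) : HA L e dV hdV dW hdW)) * ((u : HA L e dV hdV dW hdW) * h))‖ₑ) * β u ∂νN ≠ ∞)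
    (C₁ : Set (SiegelDeltaQuot L e dV hdV dW hdW))
    (hC₁ : ∀ x, x ∈ C₁ ↔ ∃ q ∈ klingen L ((IsCMField.complexConj L : L ≃ₐ[Fp L] L) : L →+* L), ∃ γ : ratH L e dV hdV dW hdW,
      (γ : HA L e dV hdV dW hdW) = Ψ (UnitaryGroup.toAdelic (Fp L) L (IsCMField.complexConj L) (2 + 2) ((StdForm.antidiagonal (2 + 2)).over L) q) ∧
        x = Quotient.mk (MulAction.orbitRel (siegelDeltaRat L e dV hdV dW hdW) (ratH L e dV hdV dW hdW)) γ) :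
    Summable fun x : C₁ => f ((((Quotient.out (x : SiegelDeltaQuot L e dV hdV dW hdW) : ratH L e dV hdV dW hdW) : HA L e dV hdV dW hdW)) * h) := by
  have hS := summable_integral_wt_smul_apply_out_subtype νN hβm hβ1 hfc h hH C₁
  have hJ : ∀ x : C₁, (∫ u, (β u).toReal • f ((((Quotient.out (x : SiegelDeltaQuot L e dV hdV dW hdW) : ratH L e dV hdV dW hdW) : HA L e dV hdV dW hdW)) *
      ((u : HA L e dV hdV dW hdW) * h)) ∂νN) = (∫ u, (β u).toReal ∂νN) •
        f ((((Quotient.out (x : SiegelDeltaQuot L e dV hdV dW hdW) : ratH L e dV hdV dW hdW) : HA L e dV hdV dW hdW)) * h) := fun x =>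
    integral_wt_smul_apply_eq_smul_of_forall_eq νN β f _ h fun u => apply_out_mul_coe_eq_of_exists_klingen hΨ ha hSA hSAi hΨP hf ((hC₁ x).1 x.2) u h
  simp_rw [hJ, Complex.real_smul] at hS
  exact (summable_mul_left_iff (Complex.ofReal_ne_zero.2 hvol)).1 hS

end Transport

end Summit.HodgeConjecture.HodgeConjecture.Cruxes.HLiu418.K2LiuKlingenConstantTermUnfold

end
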